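import Summits.QuantumFields.YangMills.Theorems.BalabanUVNodesN12WindowGaugeLetterUniform
import Literature.MathematicalPhysics.QuantumFieldTheory.Balaban1983to89.B15Prop1WindowDirectPackageFromLetters
import HarnessLib

/-!
# BalabanUVNodes ∕ N12 — THE `k`-UNIFORM WINDOW GAUGE LETTER IN THE SOCKET's SHAPE: `B15Prop1WindowDirectPackageFromLetters.hWD_of_windowLetters_on`'s binder `hσW` (p658881 :108–122), per
# instance and in family form, from `N12WindowGaugeLetterUniform.exists_windowGauge_uniform_le` — general `Z`, no letter off the window, tolerance floor `C(d,L)·ε + m′·ρn` INDEPENDENT OF `k`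

Cell `pub-ymgap` (HUMAN RULINGS D-0062 ∕ D-0149), WIDTH SEAT `pub-ymgap-dag-n12-w6` g7 (node N12 = [B15]; key K1⁹ `stmt-QuantumFields-27364`, `--kind proof --supports … --as helper`;
count-neutral).  THEOREMS ONLY (0 `def`, 0 `instance`, 0 `sorry`); one `obtain` each on this seat's `…N12WindowGaugeLetterUniform` (the graded edition of p671561 ∕ p671844).

WHAT.  The twin of `…N12WindowGaugeLetterLocalSocket` (p671844) on the `k`-UNIFORM window gauge: ★★★ `hσW_uniform_of_plaqSmall` (per instance; p658881's `hσW` body — `hu` ∧ C1_window(`Wp`, δc) ∧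
FEEDS(δW) — for ANY `δc, δW ≥ ((4d+m′+3)²·L²∕4 + 24·m′·((d+2)L)²∕4)·ε + m′·ρn`), ★★★ `hσW_on_uniform_of_plaqSmall` (the FAMILY form, binder-for-binder the socket's `hσW`, datum `W := ext i V_k`,
region `𝒞 := boxBonds (LO i) (HI i)`, `hD := hnV`; FREE `ε i` — the frame a volume∕level bookkeeping can later feed with print's graded [15] Thm 1 (8)), ★★★ `hσW_on_uniform_of_class` (the same with
the ONE level-`(k_i−1)` plaquette letter read off the minimiser's own class, `ε i := εreg`).  DISPLAYED per instance, compared with p671844: the plaquette letter is asked at level `k_i − 1` ONLY; the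
radii rows `hMrad`∕`hM₁` are REPLACED by the window's nearness row `hXΩ` (every point of `X i` is `walkEnd x₀ w₀`, `x₀ ∈ Ω_{k_i}(Z_i)`, `|w₀| ≤ D₀ i` — from dag-n12-w4's `hΩw` + `feeds_witness`) and
the collar row `hfit : D₀ i + 3ℓ_k + (m′+5)L^k + ((d+4)L+2)·Σ_{l<k}Lˡ + 4 ≤ L^{k−1}·M₁`; numerics (`c hkc hc`, `ε` ×4, `hdiv`), `hBox`, `hWX`, `hfeedsX` as there; the tolerance floors are `k`-FREE.

HONEST FRAMING.  ∃∕∀ bookkeeping by name; the minimiser ([15] Thm 1 ∕ (E)), the plaquette letter ∕ class, the region datum, the window rows and the numerics stay HYPOTHESES; the constants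
are `C(d, L)` — uniform in `k` and in the volume, NOT print's `O(1)` bookkeeping of [15] (16)–(18) verbatim; nothing of Bałaban's asserted; count-neutral; N12 NOT discharged; K1⁹ NOT closed;
counts unmoved (typed 28∕28 · discharged 5∕27); one finite 𝕋⁴ programme at fixed `ε = L^{-K}` — R4 closes the conditional rung `BalabanLadder.UV` only; no summit statement is proved here
and NOT the Yang–Mills mass gap (Clay); nothing continuum ∕ ℝ⁴ ∕ OS.

References: [Balaban1989LargeFieldII] CMP 122 (1989) 355–392, p.357; [Balaban1985Variational] CMP 102 (1985) 277–309, (2)–(4) p.278, Thm 1 (8) p.279, (16)–(18) p.280; [Balaban1985Averaging]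
CMP 98 (1985) 17–51, Prop. 2 (52)–(53) p.26; [Balaban1988Convergent] CMP 119 (1988) 243–285, (2.2) p.255, (2.11)–(2.13) pp.256–257, (2.16) p.257.
-/

noncomputable section

open scoped Matrix.Norms.L2Operator BigOperators

namespace Summit.QuantumFields.YangMills.BalabanUVNodes.N12WindowGaugeLetterUniformSocket

open Literature.MathematicalPhysics.QuantumFieldTheory.Balaban1983to89
open T4Continuum GaugeField B15DeterminingSets BlockAveraging
open T4CubeChartGnomonic (SU2)
open B16Sect1Backgrounds (toMS)
open T4AxialGaugeSmallField (boxBonds castSite)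
open B16Eq18Proof (box)
open B14.Eq213MaximalDomains (side)
open B14.Eq213DetSet (Bj maxDomT)
open B14.Eq216Concrete (feeds)
open B14.Eq22Determines (blockIter)
open B8Eq17ClassAkV1 (plaqsOf)
open B15Prop1Carrier (plaqsInside)
open ExpMeanLog (deltaSU)
open Literature.MathematicalPhysics.QuantumFieldTheory.BalabanImbrieJaffe1984to88.BIJ85Eq453GaugeField (qsstarGIter0)
open Summit.QuantumFields.YangMills.BalabanUVNodes.N12WindowGaugeLetterUniform (exists_windowGauge_uniform_le)

/-! ## The window gauge letter (σ)_W of the direct road: per instance, and the family form of `hWD_of_windowLetters_on`'s binder `hσW` -/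

/-- ★★★ **THE WINDOW GAUGE LETTER (σ)_W OF THE DIRECT ROAD, PER INSTANCE, `k`-UNIFORM.**  `exists_windowGauge_uniform_le` read in the shape of the (WD) package's letter (dag-n12-c's
`B15Prop1WindowDirectPackageFromLetters.hWD_of_windowLetters_on`, binder `hσW`): a residual gauge `σ` of the minimiser with the ROOT LETTER `hu`, `σ • U₀` bond-wise `δc`-near `1` on the four bonds of
every plaquette of the window `Wp`, and `δW`-near `1` on the feeds of the four bonds of every `(e₀, e_ν′)`-plaquette of the window box `box (n+3) (lo−2)` (level `k`) — for ANY `δc, δW` dominating the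
`k`-FREE tolerance `((4d+m′+3)²·L²∕4 + 24·m′·((d+2)L)²∕4)·ε + m′·ρn`, from ONE plaquette letter at level `k − 1`, the window's nearness to `Ω_k` (`hXΩ`, `hfit`), the region-box row `hBox` and the two
window rows `hWX`, `hfeedsX`.  No letter off the window; no condition on the shape of `Ω₁(Z)`.
[cite: Balaban1989LargeFieldII, p.357; Balaban1985Variational, (4) p.278, (16)–(18) p.280; Balaban1988Convergent, (2.2) p.255, (2.11)–(2.12) p.256, (2.16) p.257] -/
theorem hσW_uniform_of_plaqSmall {F : T4Family} (ν : Node00.Stage7Numerics) (Kt : ℕ) (h0 : 0 < (F.P Kt).d) {k : ℕ} (hk0 : 0 < k) (hk : k ≤ (F.P Kt).m + (F.P Kt).K)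
    (hdiv : side (F.P Kt).L ν.M₁ k ∣ (F.P Kt).sitesPerDir 0) (Z : Set (Site (F.P Kt) 0))
    {c : ℕ} (hkc : k + c ≤ (F.P Kt).m + (F.P Kt).K) (hc : 4 * (F.P Kt).d + (3 * ((F.P Kt).d * (((F.P Kt).L - 1) / 2)) + 5) + 3 < 2 * (F.P Kt).L ^ c)
    {ρn : ℝ} (hρn : 0 ≤ ρn)
    (W : GaugeField (F.P Kt) k SU2) (𝒞 : Set (PBond (F.P Kt) k)) (hD : ∀ c ∈ 𝒞, dist1 (W c) ≤ ρn)
    {U₀ : GaugeField (F.P Kt) 0 SU2}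
    (hmin : IsMinimizer (Node00.avOfRecord F 2 Kt) (Node00.regMSCoPOfRecord F 2 ν Kt k (maxDomT ν.M₁ Z)) (Bj ν.M₁ Z k)
      (avgFamily (Node00.avOfRecord F 2 Kt) (qsstarGIter0 k W)) U₀)
    {ε : ℝ} (hεpos : 0 < ε)
    -- ONE graded plaquette letter at level `k − 1` ([15] Thm 1 (8) ∕ the class), FREE `ε`, Prop. 2-small
    (hUk : PlaqSmallOn (plaqsOf (Node00.topSeq (Node00.suppDomOfRecord F ν Kt (maxDomT ν.M₁ Z)) (maxDomT ν.M₁ Z) (k - 1))) (ε * (F.P Kt).eta (k - 1) ^ 2) U₀)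
    (hα3 : (143 * (((((F.P Kt).d + 4 : ℕ) : ℝ)) ^ 2 / 4) ^ 2) * (ε * (F.P Kt).L ^ 2) ≤ 1 / 3)
    (hα2 : 2 * (ε * (F.P Kt).L ^ 2) ≤ 2 * deltaSU (Fin 2) / ((((F.P Kt).d + 4) * (F.P Kt).L : ℕ) : ℝ) ^ 2)
    (haN : (((((F.P Kt).d + 2) * (F.P Kt).L : ℕ) : ℝ) ^ 2 / 4) * (2 * (ε * (F.P Kt).L ^ 2)) < deltaSU (Fin 2))
    -- THE WINDOW: within `D₀` fine steps of `Ω_k`, the collar numerics, and the region-box letter AT the window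
    (X : Set (Site (F.P Kt) 0)) {D₀ : ℕ} (hXΩ : ∀ x ∈ X, ∃ x₀ ∈ maxDomT ν.M₁ Z k, ∃ w₀ : List (Letter (F.P Kt).d), w₀.length ≤ D₀ ∧ walkEnd x₀ w₀ = x)
    (hfit : D₀ + 3 * (∑ i ∈ Finset.range (k + 1), ((F.P Kt).d * (((F.P Kt).L ^ i - 1) / 2) + 1)) + ((3 * ((F.P Kt).d * (((F.P Kt).L - 1) / 2)) + 5) + 5) * (F.P Kt).L ^ k +
      (((F.P Kt).d + 4) * (F.P Kt).L + 2) * (∑ l ∈ Finset.Ico 0 k, (F.P Kt).L ^ l) + 4 ≤ (F.P Kt).L ^ (k - 1) * ν.M₁)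
    (hBox : ∀ x ∈ X, ∀ w : List (Letter (F.P Kt).d), w.length ≤ (∑ i ∈ Finset.range (k + 1), ((F.P Kt).d * (((F.P Kt).L ^ i - 1) / 2) + 1)) + (3 * ((F.P Kt).d * (((F.P Kt).L - 1) / 2)) + 5) * (F.P Kt).L ^ k + (F.P Kt).L ^ k →
      ∀ μ : Fin (F.P Kt).d, (⟨blockIter k (walkEnd x w), μ⟩ : PBond (F.P Kt) k) ∈ 𝒞)
    -- the WINDOW of the direct road: its level-`k` box `box (n+3) (lo−2)` and the plaquette window `Wp`, with the two window rows
    (lo hi : Fin (F.P Kt).d → ℤ) (Wp : Finset (Plaq (F.P Kt) 0))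
    (hWX : ∀ p ∈ Wp, p.src ∈ X ∧ p.src.shift p.μ ∈ X ∧ p.src.shift p.ν ∈ X ∧ (p.src.shift p.μ).shift p.ν ∈ X ∧ (p.src.shift p.ν).shift p.μ ∈ X)
    (hfeedsX : ∀ (ν' : Fin (F.P Kt).d), ∀ z ∈ box (fun κ => (hi κ - lo κ + 1).toNat + 3) (fun κ => lo κ - 2), ∀ b₀ : PBond (F.P Kt) 0,
      (b₀ ∈ feeds k (⟨(castSite z : Site (F.P Kt) k), ⟨0, h0⟩⟩ : PBond (F.P Kt) k) ∨
        b₀ ∈ feeds k (⟨((castSite z : Site (F.P Kt) k)).shift ⟨0, h0⟩, ν'⟩ : PBond (F.P Kt) k) ∨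
        b₀ ∈ feeds k (⟨((castSite z : Site (F.P Kt) k)).shift ν', ⟨0, h0⟩⟩ : PBond (F.P Kt) k) ∨
        b₀ ∈ feeds k (⟨(castSite z : Site (F.P Kt) k), ν'⟩ : PBond (F.P Kt) k)) → b₀.src ∈ X ∧ b₀.tgt ∈ X)
    -- any tolerances dominating the `k`-free window tolerance of `exists_windowGauge_uniform_le`
    {δc δW : ℝ}
    (hδc : ((((4 * (F.P Kt).d + (3 * ((F.P Kt).d * (((F.P Kt).L - 1) / 2)) + 5) + 3 : ℕ) : ℝ)) ^ 2 * ((F.P Kt).L : ℝ) ^ 2 / 4 + ((3 * ((F.P Kt).d * (((F.P Kt).L - 1) / 2)) + 5 : ℕ) : ℝ) * (24 * (((((F.P Kt).d + 2) * (F.P Kt).L : ℕ) : ℝ) ^ 2 / 4))) * ε + ((3 * ((F.P Kt).d * (((F.P Kt).L - 1) / 2)) + 5 : ℕ) : ℝ) * ρn ≤ δc)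
    (hδW : ((((4 * (F.P Kt).d + (3 * ((F.P Kt).d * (((F.P Kt).L - 1) / 2)) + 5) + 3 : ℕ) : ℝ)) ^ 2 * ((F.P Kt).L : ℝ) ^ 2 / 4 + ((3 * ((F.P Kt).d * (((F.P Kt).L - 1) / 2)) + 5 : ℕ) : ℝ) * (24 * (((((F.P Kt).d + 2) * (F.P Kt).L : ℕ) : ℝ) ^ 2 / 4))) * ε + ((3 * ((F.P Kt).d * (((F.P Kt).L - 1) / 2)) + 5 : ℕ) : ℝ) * ρn ≤ δW) :
    ∃ σ : GaugeTransf (F.P Kt) 0 SU2,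
      (∀ j, j ≤ k → ∀ b ∈ bondsOf (Bj ν.M₁ Z k j), toMS σ j b.src = 1 ∧ toMS σ j b.tgt = 1) ∧
      (∀ p ∈ Wp, ‖((gaugeAct σ U₀ ⟨p.src, p.μ⟩ : SU2) : Matrix (Fin 2) (Fin 2) ℂ) - 1‖ ≤ δc ∧ ‖((gaugeAct σ U₀ ⟨p.src.shift p.μ, p.ν⟩ : SU2) : Matrix (Fin 2) (Fin 2) ℂ) - 1‖ ≤ δc ∧
        ‖((gaugeAct σ U₀ ⟨p.src.shift p.ν, p.μ⟩ : SU2) : Matrix (Fin 2) (Fin 2) ℂ) - 1‖ ≤ δc ∧ ‖((gaugeAct σ U₀ ⟨p.src, p.ν⟩ : SU2) : Matrix (Fin 2) (Fin 2) ℂ) - 1‖ ≤ δc) ∧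
      (∀ (ν' : Fin (F.P Kt).d), ∀ z ∈ box (fun κ => (hi κ - lo κ + 1).toNat + 3) (fun κ => lo κ - 2), ∀ b₀ : PBond (F.P Kt) 0,
        (b₀ ∈ feeds k (⟨(castSite z : Site (F.P Kt) k), ⟨0, h0⟩⟩ : PBond (F.P Kt) k) ∨
          b₀ ∈ feeds k (⟨((castSite z : Site (F.P Kt) k)).shift ⟨0, h0⟩, ν'⟩ : PBond (F.P Kt) k) ∨
          b₀ ∈ feeds k (⟨((castSite z : Site (F.P Kt) k)).shift ν', ⟨0, h0⟩⟩ : PBond (F.P Kt) k) ∨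
          b₀ ∈ feeds k (⟨(castSite z : Site (F.P Kt) k), ν'⟩ : PBond (F.P Kt) k)) →
        ‖((gaugeAct σ U₀ b₀ : SU2) : Matrix (Fin 2) (Fin 2) ℂ) - 1‖ ≤ δW) := by
  obtain ⟨σ, hu, -, hb⟩ := exists_windowGauge_uniform_le ν Kt hk0 hk hdiv Z hkc hc hρn W 𝒞 hD hmin hεpos hUk hα3 hα2 haN X hXΩ hfit hBox
  refine ⟨σ, hu, fun p hp => ?_, fun ν' z hz b₀ hb₀ => ?_⟩
  · obtain ⟨h1, h2, h3, h4, h5⟩ := hWX p hp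
    exact ⟨(hb ⟨p.src, p.μ⟩ h1 h2).trans hδc, (hb ⟨p.src.shift p.μ, p.ν⟩ h2 h4).trans hδc, (hb ⟨p.src.shift p.ν, p.μ⟩ h3 h5).trans hδc,
      (hb ⟨p.src, p.ν⟩ h1 h3).trans hδc⟩
  · obtain ⟨hs, ht⟩ := hfeedsX ν' z hz b₀ hb₀
    exact (hb b₀ hs ht).trans hδW

/-- ★★★ **THE FAMILY FORM, FREE SCALE — LITERALLY THE BINDER `hσW` OF `hWD_of_windowLetters_on` (p658881 :108–122), `k`-UNIFORM FLOORS**, datum `W := ext i V_k`, region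
`𝒞 := boxBonds (LO i) (HI i)`, `hD := hnV`: per instance `i`, from the numerics, ONE graded plaquette letter at level `k_i − 1` at every (2.12) minimiser of every guarded normalised datum ([15] Thm 1 (8)
at a free scale `ε i` — the frame print's graded bookkeeping feeds), the window `X i` within `D₀ i` of `Ω_{k_i}(Z_i)` with the collar row `hfit`, the region-box row and the two window rows, and
tolerances `δc i, δW i ≥ ((4d+m′+3)²·L²∕4 + 24·m′·((d+2)L)²∕4)·ε i + m′·ρn i` (no `k_i`!) — the window gauge letter (σ)_W.
[cite: Balaban1989LargeFieldII, p.357; Balaban1985Variational, (4) p.278, Thm 1 (8) p.279, (16)–(18) p.280; Balaban1988Convergent, (2.2) p.255, (2.11)–(2.13) pp.256–257, (2.16) p.257] -/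
theorem hσW_on_uniform_of_plaqSmall {F : T4Family} (ν : Node00.Stage7Numerics) (Kt : ℕ) (h0 : 0 < (F.P Kt).d) {ι : Type}
    (Z Λ : ι → Set (Site (F.P Kt) 0)) (k : ι → ℕ) (hk0 : ∀ i, 0 < k i) (hk : ∀ i, k i ≤ (F.P Kt).m + (F.P Kt).K)
    (eR : ι → ℝ) (lo hi : ι → Fin (F.P Kt).d → ℤ)
    (ext : ∀ i, GaugeField (F.P Kt) (k i) SU2 → GaugeField (F.P Kt) (k i) SU2)
    (LO HI : ι → Fin (F.P Kt).d → ℤ) (ρn : ι → ℝ) (hρn : ∀ i, 0 ≤ ρn i)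
    (hdiv : ∀ i, side (F.P Kt).L ν.M₁ (k i) ∣ (F.P Kt).sitesPerDir 0)
    -- NUMERICS per instance: level guard (no wrapping); radii
    (c : ι → ℕ) (hkc : ∀ i, k i + c i ≤ (F.P Kt).m + (F.P Kt).K) (hc : ∀ i, 4 * (F.P Kt).d + (3 * ((F.P Kt).d * (((F.P Kt).L - 1) / 2)) + 5) + 3 < 2 * (F.P Kt).L ^ c i)
    (W : ι → Finset (Plaq (F.P Kt) 0))
    -- ONE graded plaquette letter at level `k i − 1`, FREE scale `ε i`, at every minimiser of every guarded normalised datum ([15] Thm 1 (8) ∕ the class), Prop. 2-small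
    {ε : ι → ℝ} (hεpos : ∀ i, 0 < ε i)
    (hα3 : ∀ i, (143 * (((((F.P Kt).d + 4 : ℕ) : ℝ)) ^ 2 / 4) ^ 2) * (ε i * (F.P Kt).L ^ 2) ≤ 1 / 3)
    (hα2 : ∀ i, 2 * (ε i * (F.P Kt).L ^ 2) ≤ 2 * deltaSU (Fin 2) / ((((F.P Kt).d + 4) * (F.P Kt).L : ℕ) : ℝ) ^ 2)
    (haN : ∀ i, (((((F.P Kt).d + 2) * (F.P Kt).L : ℕ) : ℝ) ^ 2 / 4) * (2 * (ε i * (F.P Kt).L ^ 2)) < deltaSU (Fin 2))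
    (hU : ∀ i (Vk : GaugeField (F.P Kt) (k i) SU2), PlaqSmallOn (plaqsInside (pts (k i) (Z i ∩ (Λ i)ᶜ))) (eR i) Vk →
      (∀ b ∈ (boxBonds (LO i) (HI i) : Set (PBond (F.P Kt) (k i))), dist1 (ext i Vk b) ≤ ρn i) →
      ∀ U₀ : GaugeField (F.P Kt) 0 SU2,
        IsMinimizer (Node00.avOfRecord F 2 Kt) (Node00.regMSCoPOfRecord F 2 ν Kt (k i) (maxDomT ν.M₁ (Z i))) (Bj ν.M₁ (Z i) (k i))
          (avgFamily (Node00.avOfRecord F 2 Kt) (qsstarGIter0 (k i) (ext i Vk))) U₀ →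
        PlaqSmallOn (plaqsOf (Node00.topSeq (Node00.suppDomOfRecord F ν Kt (maxDomT ν.M₁ (Z i))) (maxDomT ν.M₁ (Z i)) (k i - 1))) (ε i * (F.P Kt).eta (k i - 1) ^ 2) U₀)
    -- the WINDOW per instance: within `D₀ i` of `Ω_{k_i}(Z_i)`, the collar numerics, the REGION-BOX ROW and the two window rows
    (X : ι → Set (Site (F.P Kt) 0)) (D₀ : ι → ℕ)
    (hXΩ : ∀ i, ∀ x ∈ X i, ∃ x₀ ∈ maxDomT ν.M₁ (Z i) (k i), ∃ w₀ : List (Letter (F.P Kt).d), w₀.length ≤ D₀ i ∧ walkEnd x₀ w₀ = x)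
    (hfit : ∀ i, D₀ i + 3 * (∑ i' ∈ Finset.range (k i + 1), ((F.P Kt).d * (((F.P Kt).L ^ i' - 1) / 2) + 1)) + ((3 * ((F.P Kt).d * (((F.P Kt).L - 1) / 2)) + 5) + 5) * (F.P Kt).L ^ k i +
      (((F.P Kt).d + 4) * (F.P Kt).L + 2) * (∑ l ∈ Finset.Ico 0 (k i), (F.P Kt).L ^ l) + 4 ≤ (F.P Kt).L ^ (k i - 1) * ν.M₁)
    (hBox : ∀ i, ∀ x ∈ X i, ∀ w : List (Letter (F.P Kt).d),
      w.length ≤ (∑ i' ∈ Finset.range (k i + 1), ((F.P Kt).d * (((F.P Kt).L ^ i' - 1) / 2) + 1)) + (3 * ((F.P Kt).d * (((F.P Kt).L - 1) / 2)) + 5) * (F.P Kt).L ^ k i + (F.P Kt).L ^ k i →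
      ∀ μ : Fin (F.P Kt).d, (⟨blockIter (k i) (walkEnd x w), μ⟩ : PBond (F.P Kt) (k i)) ∈ (boxBonds (LO i) (HI i) : Set (PBond (F.P Kt) (k i))))
    (hWX : ∀ i, ∀ p ∈ W i, p.src ∈ X i ∧ p.src.shift p.μ ∈ X i ∧ p.src.shift p.ν ∈ X i ∧ (p.src.shift p.μ).shift p.ν ∈ X i ∧ (p.src.shift p.ν).shift p.μ ∈ X i)
    (hfeedsX : ∀ i (ν' : Fin (F.P Kt).d), ∀ z ∈ box (fun κ => (hi i κ - lo i κ + 1).toNat + 3) (fun κ => lo i κ - 2), ∀ b₀ : PBond (F.P Kt) 0,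
      (b₀ ∈ feeds (k i) (⟨(castSite z : Site (F.P Kt) (k i)), ⟨0, h0⟩⟩ : PBond (F.P Kt) (k i)) ∨
        b₀ ∈ feeds (k i) (⟨((castSite z : Site (F.P Kt) (k i))).shift ⟨0, h0⟩, ν'⟩ : PBond (F.P Kt) (k i)) ∨
        b₀ ∈ feeds (k i) (⟨((castSite z : Site (F.P Kt) (k i))).shift ν', ⟨0, h0⟩⟩ : PBond (F.P Kt) (k i)) ∨
        b₀ ∈ feeds (k i) (⟨(castSite z : Site (F.P Kt) (k i)), ν'⟩ : PBond (F.P Kt) (k i))) → b₀.src ∈ X i ∧ b₀.tgt ∈ X i)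
    -- the instance's tolerances dominate the `k`-FREE window tolerance of `exists_windowGauge_uniform_le`
    {δc δW : ι → ℝ}
    (hδc : ∀ i, ((((4 * (F.P Kt).d + (3 * ((F.P Kt).d * (((F.P Kt).L - 1) / 2)) + 5) + 3 : ℕ) : ℝ)) ^ 2 * ((F.P Kt).L : ℝ) ^ 2 / 4 + ((3 * ((F.P Kt).d * (((F.P Kt).L - 1) / 2)) + 5 : ℕ) : ℝ) * (24 * (((((F.P Kt).d + 2) * (F.P Kt).L : ℕ) : ℝ) ^ 2 / 4))) * ε i + ((3 * ((F.P Kt).d * (((F.P Kt).L - 1) / 2)) + 5 : ℕ) : ℝ) * ρn i ≤ δc i)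
    (hδW : ∀ i, ((((4 * (F.P Kt).d + (3 * ((F.P Kt).d * (((F.P Kt).L - 1) / 2)) + 5) + 3 : ℕ) : ℝ)) ^ 2 * ((F.P Kt).L : ℝ) ^ 2 / 4 + ((3 * ((F.P Kt).d * (((F.P Kt).L - 1) / 2)) + 5 : ℕ) : ℝ) * (24 * (((((F.P Kt).d + 2) * (F.P Kt).L : ℕ) : ℝ) ^ 2 / 4))) * ε i + ((3 * ((F.P Kt).d * (((F.P Kt).L - 1) / 2)) + 5 : ℕ) : ℝ) * ρn i ≤ δW i) :
    ∀ i (Vk : GaugeField (F.P Kt) (k i) SU2), PlaqSmallOn (plaqsInside (pts (k i) (Z i ∩ (Λ i)ᶜ))) (eR i) Vk →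
      (∀ b ∈ (boxBonds (LO i) (HI i) : Set (PBond (F.P Kt) (k i))), dist1 (ext i Vk b) ≤ ρn i) →
      ∀ U₀ : GaugeField (F.P Kt) 0 SU2,
        IsMinimizer (Node00.avOfRecord F 2 Kt) (Node00.regMSCoPOfRecord F 2 ν Kt (k i) (maxDomT ν.M₁ (Z i))) (Bj ν.M₁ (Z i) (k i))
          (avgFamily (Node00.avOfRecord F 2 Kt) (qsstarGIter0 (k i) (ext i Vk))) U₀ →
        ∃ σ : GaugeTransf (F.P Kt) 0 SU2,
          (∀ j, j ≤ k i → ∀ b ∈ bondsOf (Bj ν.M₁ (Z i) (k i) j), toMS σ j b.src = 1 ∧ toMS σ j b.tgt = 1) ∧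
          (∀ p ∈ W i, ‖((gaugeAct σ U₀ ⟨p.src, p.μ⟩ : SU2) : Matrix (Fin 2) (Fin 2) ℂ) - 1‖ ≤ δc i ∧ ‖((gaugeAct σ U₀ ⟨p.src.shift p.μ, p.ν⟩ : SU2) : Matrix (Fin 2) (Fin 2) ℂ) - 1‖ ≤ δc i ∧
            ‖((gaugeAct σ U₀ ⟨p.src.shift p.ν, p.μ⟩ : SU2) : Matrix (Fin 2) (Fin 2) ℂ) - 1‖ ≤ δc i ∧ ‖((gaugeAct σ U₀ ⟨p.src, p.ν⟩ : SU2) : Matrix (Fin 2) (Fin 2) ℂ) - 1‖ ≤ δc i) ∧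
          (∀ (ν' : Fin (F.P Kt).d), ∀ z ∈ box (fun κ => (hi i κ - lo i κ + 1).toNat + 3) (fun κ => lo i κ - 2), ∀ b₀ : PBond (F.P Kt) 0,
            (b₀ ∈ feeds (k i) (⟨(castSite z : Site (F.P Kt) (k i)), ⟨0, h0⟩⟩ : PBond (F.P Kt) (k i)) ∨
              b₀ ∈ feeds (k i) (⟨((castSite z : Site (F.P Kt) (k i))).shift ⟨0, h0⟩, ν'⟩ : PBond (F.P Kt) (k i)) ∨
              b₀ ∈ feeds (k i) (⟨((castSite z : Site (F.P Kt) (k i))).shift ν', ⟨0, h0⟩⟩ : PBond (F.P Kt) (k i)) ∨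
              b₀ ∈ feeds (k i) (⟨(castSite z : Site (F.P Kt) (k i)), ν'⟩ : PBond (F.P Kt) (k i))) →
            ‖((gaugeAct σ U₀ b₀ : SU2) : Matrix (Fin 2) (Fin 2) ℂ) - 1‖ ≤ δW i) := by
  intro i Vk hV hnV U₀ hmin0
  exact hσW_uniform_of_plaqSmall ν Kt h0 (hk0 i) (hk i) (hdiv i) (Z i) (hkc i) (hc i) (hρn i) (ext i Vk) (boxBonds (LO i) (HI i)) hnV hmin0 (hεpos i)
    (hU i Vk hV hnV U₀ hmin0) (hα3 i) (hα2 i) (haN i) (X i) (hXΩ i) (hfit i) (hBox i) (lo i) (hi i) (W i) (hWX i) (hfeedsX i) (hδc i) (hδW i)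

/-- ★★★ **THE FAMILY FORM, CLASS CORNER, `k`-UNIFORM FLOORS** — `hσW_on_uniform_of_plaqSmall` with the ONE level-`(k_i−1)` plaquette letter read off the minimiser's OWN CLASS OF RECORD
(`hmin.1`, [15] (2) ∕ [6] (1.7) on `Ω_{k_i−1}`) at `ε i := εreg`: the binder `hσW` of `hWD_of_windowLetters_on` from NUMERICS (`εreg` ×4, level guard, `hdiv`), the window rows (`hXΩ`, `hfit`, `hBox`,
`hWX`, `hfeedsX` — lattice geometry of the instance) and the `k`-FREE tolerance floors `δc i, δW i ≥ ((4d+m′+3)²·L²∕4 + 24·m′·((d+2)L)²∕4)·εreg + m′·ρn i` ONLY.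
[cite: Balaban1985Variational, (2)–(4) p.278, (16)–(18) p.280; Balaban1985RegularSpaces, (1.7) p.77, (1.19) p.79; Balaban1985Averaging, Prop. 2 (52)–(53) p.26; Balaban1988Convergent, (2.12)–(2.13) pp.256–257, (2.16) p.257] -/
theorem hσW_on_uniform_of_class {F : T4Family} (ν : Node00.Stage7Numerics) (Kt : ℕ) (h0 : 0 < (F.P Kt).d) {ι : Type}
    (Z Λ : ι → Set (Site (F.P Kt) 0)) (k : ι → ℕ) (hk0 : ∀ i, 0 < k i) (hk : ∀ i, k i ≤ (F.P Kt).m + (F.P Kt).K)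
    (eR : ι → ℝ) (lo hi : ι → Fin (F.P Kt).d → ℤ)
    (ext : ∀ i, GaugeField (F.P Kt) (k i) SU2 → GaugeField (F.P Kt) (k i) SU2)
    (LO HI : ι → Fin (F.P Kt).d → ℤ) (ρn : ι → ℝ) (hρn : ∀ i, 0 ≤ ρn i)
    (hdiv : ∀ i, side (F.P Kt).L ν.M₁ (k i) ∣ (F.P Kt).sitesPerDir 0)
    -- NUMERICS per instance: level guard (no wrapping); radii
    (c : ι → ℕ) (hkc : ∀ i, k i + c i ≤ (F.P Kt).m + (F.P Kt).K) (hc : ∀ i, 4 * (F.P Kt).d + (3 * ((F.P Kt).d * (((F.P Kt).L - 1) / 2)) + 5) + 3 < 2 * (F.P Kt).L ^ c i)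
    (W : ι → Finset (Plaq (F.P Kt) 0))
    -- the class threshold `εreg`: positive and small
    (hεpos : 0 < ν.εreg)
    (hα3 : (143 * (((((F.P Kt).d + 4 : ℕ) : ℝ)) ^ 2 / 4) ^ 2) * (ν.εreg * (F.P Kt).L ^ 2) ≤ 1 / 3)
    (hα2 : 2 * (ν.εreg * (F.P Kt).L ^ 2) ≤ 2 * deltaSU (Fin 2) / ((((F.P Kt).d + 4) * (F.P Kt).L : ℕ) : ℝ) ^ 2)
    (haN : (((((F.P Kt).d + 2) * (F.P Kt).L : ℕ) : ℝ) ^ 2 / 4) * (2 * (ν.εreg * (F.P Kt).L ^ 2)) < deltaSU (Fin 2))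
    -- the WINDOW per instance: within `D₀ i` of `Ω_{k_i}(Z_i)`, the collar numerics, the REGION-BOX ROW and the two window rows
    (X : ι → Set (Site (F.P Kt) 0)) (D₀ : ι → ℕ)
    (hXΩ : ∀ i, ∀ x ∈ X i, ∃ x₀ ∈ maxDomT ν.M₁ (Z i) (k i), ∃ w₀ : List (Letter (F.P Kt).d), w₀.length ≤ D₀ i ∧ walkEnd x₀ w₀ = x)
    (hfit : ∀ i, D₀ i + 3 * (∑ i' ∈ Finset.range (k i + 1), ((F.P Kt).d * (((F.P Kt).L ^ i' - 1) / 2) + 1)) + ((3 * ((F.P Kt).d * (((F.P Kt).L - 1) / 2)) + 5) + 5) * (F.P Kt).L ^ k i +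
      (((F.P Kt).d + 4) * (F.P Kt).L + 2) * (∑ l ∈ Finset.Ico 0 (k i), (F.P Kt).L ^ l) + 4 ≤ (F.P Kt).L ^ (k i - 1) * ν.M₁)
    (hBox : ∀ i, ∀ x ∈ X i, ∀ w : List (Letter (F.P Kt).d),
      w.length ≤ (∑ i' ∈ Finset.range (k i + 1), ((F.P Kt).d * (((F.P Kt).L ^ i' - 1) / 2) + 1)) + (3 * ((F.P Kt).d * (((F.P Kt).L - 1) / 2)) + 5) * (F.P Kt).L ^ k i + (F.P Kt).L ^ k i →
      ∀ μ : Fin (F.P Kt).d, (⟨blockIter (k i) (walkEnd x w), μ⟩ : PBond (F.P Kt) (k i)) ∈ (boxBonds (LO i) (HI i) : Set (PBond (F.P Kt) (k i))))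
    (hWX : ∀ i, ∀ p ∈ W i, p.src ∈ X i ∧ p.src.shift p.μ ∈ X i ∧ p.src.shift p.ν ∈ X i ∧ (p.src.shift p.μ).shift p.ν ∈ X i ∧ (p.src.shift p.ν).shift p.μ ∈ X i)
    (hfeedsX : ∀ i (ν' : Fin (F.P Kt).d), ∀ z ∈ box (fun κ => (hi i κ - lo i κ + 1).toNat + 3) (fun κ => lo i κ - 2), ∀ b₀ : PBond (F.P Kt) 0,
      (b₀ ∈ feeds (k i) (⟨(castSite z : Site (F.P Kt) (k i)), ⟨0, h0⟩⟩ : PBond (F.P Kt) (k i)) ∨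
        b₀ ∈ feeds (k i) (⟨((castSite z : Site (F.P Kt) (k i))).shift ⟨0, h0⟩, ν'⟩ : PBond (F.P Kt) (k i)) ∨
        b₀ ∈ feeds (k i) (⟨((castSite z : Site (F.P Kt) (k i))).shift ν', ⟨0, h0⟩⟩ : PBond (F.P Kt) (k i)) ∨
        b₀ ∈ feeds (k i) (⟨(castSite z : Site (F.P Kt) (k i)), ν'⟩ : PBond (F.P Kt) (k i))) → b₀.src ∈ X i ∧ b₀.tgt ∈ X i)
    -- the instance's tolerances dominate the `k`-free window tolerance at `ε := εreg`
    {δc δW : ι → ℝ}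
    (hδc : ∀ i, ((((4 * (F.P Kt).d + (3 * ((F.P Kt).d * (((F.P Kt).L - 1) / 2)) + 5) + 3 : ℕ) : ℝ)) ^ 2 * ((F.P Kt).L : ℝ) ^ 2 / 4 + ((3 * ((F.P Kt).d * (((F.P Kt).L - 1) / 2)) + 5 : ℕ) : ℝ) * (24 * (((((F.P Kt).d + 2) * (F.P Kt).L : ℕ) : ℝ) ^ 2 / 4))) * ν.εreg + ((3 * ((F.P Kt).d * (((F.P Kt).L - 1) / 2)) + 5 : ℕ) : ℝ) * ρn i ≤ δc i)
    (hδW : ∀ i, ((((4 * (F.P Kt).d + (3 * ((F.P Kt).d * (((F.P Kt).L - 1) / 2)) + 5) + 3 : ℕ) : ℝ)) ^ 2 * ((F.P Kt).L : ℝ) ^ 2 / 4 + ((3 * ((F.P Kt).d * (((F.P Kt).L - 1) / 2)) + 5 : ℕ) : ℝ) * (24 * (((((F.P Kt).d + 2) * (F.P Kt).L : ℕ) : ℝ) ^ 2 / 4))) * ν.εreg + ((3 * ((F.P Kt).d * (((F.P Kt).L - 1) / 2)) + 5 : ℕ) : ℝ) * ρn i ≤ δW i) :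
    ∀ i (Vk : GaugeField (F.P Kt) (k i) SU2), PlaqSmallOn (plaqsInside (pts (k i) (Z i ∩ (Λ i)ᶜ))) (eR i) Vk →
      (∀ b ∈ (boxBonds (LO i) (HI i) : Set (PBond (F.P Kt) (k i))), dist1 (ext i Vk b) ≤ ρn i) →
      ∀ U₀ : GaugeField (F.P Kt) 0 SU2,
        IsMinimizer (Node00.avOfRecord F 2 Kt) (Node00.regMSCoPOfRecord F 2 ν Kt (k i) (maxDomT ν.M₁ (Z i))) (Bj ν.M₁ (Z i) (k i))
          (avgFamily (Node00.avOfRecord F 2 Kt) (qsstarGIter0 (k i) (ext i Vk))) U₀ →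
        ∃ σ : GaugeTransf (F.P Kt) 0 SU2,
          (∀ j, j ≤ k i → ∀ b ∈ bondsOf (Bj ν.M₁ (Z i) (k i) j), toMS σ j b.src = 1 ∧ toMS σ j b.tgt = 1) ∧
          (∀ p ∈ W i, ‖((gaugeAct σ U₀ ⟨p.src, p.μ⟩ : SU2) : Matrix (Fin 2) (Fin 2) ℂ) - 1‖ ≤ δc i ∧ ‖((gaugeAct σ U₀ ⟨p.src.shift p.μ, p.ν⟩ : SU2) : Matrix (Fin 2) (Fin 2) ℂ) - 1‖ ≤ δc i ∧
            ‖((gaugeAct σ U₀ ⟨p.src.shift p.ν, p.μ⟩ : SU2) : Matrix (Fin 2) (Fin 2) ℂ) - 1‖ ≤ δc i ∧ ‖((gaugeAct σ U₀ ⟨p.src, p.ν⟩ : SU2) : Matrix (Fin 2) (Fin 2) ℂ) - 1‖ ≤ δc i) ∧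
          (∀ (ν' : Fin (F.P Kt).d), ∀ z ∈ box (fun κ => (hi i κ - lo i κ + 1).toNat + 3) (fun κ => lo i κ - 2), ∀ b₀ : PBond (F.P Kt) 0,
            (b₀ ∈ feeds (k i) (⟨(castSite z : Site (F.P Kt) (k i)), ⟨0, h0⟩⟩ : PBond (F.P Kt) (k i)) ∨
              b₀ ∈ feeds (k i) (⟨((castSite z : Site (F.P Kt) (k i))).shift ⟨0, h0⟩, ν'⟩ : PBond (F.P Kt) (k i)) ∨
              b₀ ∈ feeds (k i) (⟨((castSite z : Site (F.P Kt) (k i))).shift ν', ⟨0, h0⟩⟩ : PBond (F.P Kt) (k i)) ∨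
              b₀ ∈ feeds (k i) (⟨(castSite z : Site (F.P Kt) (k i)), ν'⟩ : PBond (F.P Kt) (k i))) →
            ‖((gaugeAct σ U₀ b₀ : SU2) : Matrix (Fin 2) (Fin 2) ℂ) - 1‖ ≤ δW i) := by
  intro i Vk _ hnV U₀ hmin0
  exact hσW_uniform_of_plaqSmall ν Kt h0 (hk0 i) (hk i) (hdiv i) (Z i) (hkc i) (hc i) (hρn i) (ext i Vk) (boxBonds (LO i) (HI i)) hnV hmin0 hεpos
    (((Node00.mem_regMSCoPOfRecord_iff F 2 ν Kt (k i) (maxDomT ν.M₁ (Z i)) U₀).1 hmin0.1).1 (k i - 1) (Nat.sub_le _ _)) hα3 hα2 haN (X i) (hXΩ i) (hfit i) (hBox i) (lo i) (hi i) (W i)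
    (hWX i) (hfeedsX i) (hδc i) (hδW i)

end Summit.QuantumFields.YangMills.BalabanUVNodes.N12WindowGaugeLetterUniformSocket

end
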